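import Mathlib
import HarnessLib.Audit
import Summits.PneNP.PneNP.Theorems.PstarNorUnitExcCore

/-!
# The blind free CROSS gate: the polar form of a UNIT has rank four; bilinear forms vanishing on a basis column (O2 / E1; prover-1 g23)

FRONTIER range-avoidance ladder, rung F-N3 (`stmt-PneNP-19007`), cell `pnp-ideate`; restricted-model proof complexity — nothing here bears on `P` versus `NP`.

Two pieces of linear algebra for the single-unit endgame of node N2 (`PstarCrossCasePUnit`):

* `apply_single_eq_zero` — a bilinear form on `Fin n → 𝔽₂` vanishing at `(e_w, e_v)` for every `w` vanishes at `(x, e_v)` for every `x`;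
* **`rank_four_of_unit_formula`** — if `polarDir mv` has the UNIT polar formula `[v ~ w in D] + [{v,w} = {σ,τ}]` for `D = {j₁, j₂}` with disjoint AND pairs
  and `σ ∈ j₁`, `τ ∈ j₂` (the conclusion of `PstarNorUnitExcCore.exc_unit_core`), then `dim rad(polarDir mv) + 4 ≤ n`: its Gram graph on `σ', σ, τ, τ'` is
  the path `σ' — σ — τ — τ'`, and `x ↦ (polarDir x e_{σ'}, polarDir x e_σ, polarDir x e_τ, polarDir x e_{τ'})` is onto `𝔽₂⁴`.
-/

set_option linter.dupNamespace false -- `Summit.PneNP.PneNP.…`: summit = sub-problem name (D-0017 single-conjunct layout)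

open Finset Module Literature.Computability.Complexity
open Summit.PneNP.PneNP.Theorems.PstarSALevel (SimpleOverlap)
open Summit.PneNP.PneNP.Theorems.PstarGapLinearised (andPair)
open Summit.PneNP.PneNP.Theorems.PstarChordEndgameTools (mem_andPair_iff)
open Summit.PneNP.PneNP.Theorems.PstarQuadRank (rad mem_rad)
open Summit.PneNP.PneNP.Theorems.PstarPathRank (AndAdj and_ne)
open Summit.PneNP.PneNP.Theorems.PstarReadSumset (V2)
open Summit.PneNP.PneNP.Theorems.PstarChordBridge (BridgeData)
open Summit.PneNP.PneNP.Theorems.PstarChordBridgeBasis (polarDir)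

namespace Summit.PneNP.PneNP.Theorems.PstarCrossUnitRank

variable {n m : ℕ}

/-- **A bilinear form vanishing on a basis column vanishes on the column.** -/
theorem apply_single_eq_zero (B : LinearMap.BilinForm (ZMod 2) (Fin n → ZMod 2)) {v : Fin n}
    (h : ∀ w, B (Pi.single w 1) (Pi.single v 1) = 0) (x : Fin n → ZMod 2) : B x (Pi.single v 1) = 0 := by
  have hzero : B.flip (Pi.single v 1) = 0 :=
    LinearMap.pi_ext' fun w => LinearMap.ext_ring (by simpa [LinearMap.flip_apply] using h w)
  have := LinearMap.congr_fun hzero x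
  simpa [LinearMap.flip_apply] using this

section

variable (I : LocalMap 4 n m) {B : BridgeData n m}

/-- **The polar form of a unit has rank four.**  See the module docstring. -/
theorem rank_four_of_unit_formula (hI : I.IsPure xorAndPred) {mv : V2} {D : Finset (Fin m)} {j₁ j₂ : Fin m} {σ τ : Fin n}
    (hD : D = {j₁, j₂}) (hdisj : Disjoint (andPair I j₁) (andPair I j₂)) (hσ : σ ∈ andPair I j₁) (hτ : τ ∈ andPair I j₂)
    (hpol : ∀ v w : Fin n, polarDir I B mv (Pi.single v 1) (Pi.single w 1) =
      (if AndAdj I D v w then 1 else 0) + (if (v = σ ∧ w = τ) ∨ (v = τ ∧ w = σ) then 1 else 0)) :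
    finrank (ZMod 2) (rad (polarDir I B mv)) + 4 ≤ finrank (ZMod 2) (Fin n → ZMod 2) := by
  classical
  set P := polarDir I B mv with hP
  -- the mates
  obtain ⟨σ', hσ'j, hσσ'⟩ : ∃ σ' : Fin n, σ' ∈ andPair I j₁ ∧ σ' ≠ σ := by
    rcases (mem_andPair_iff I j₁ σ).1 hσ with h | h
    · exact ⟨I.vars j₁ 3, (mem_andPair_iff I j₁ _).2 (Or.inr rfl), fun e => and_ne I hI j₁ (h.symm.trans e.symm)⟩
    · exact ⟨I.vars j₁ 2, (mem_andPair_iff I j₁ _).2 (Or.inl rfl), fun e => and_ne I hI j₁ (e.trans h)⟩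
  obtain ⟨τ', hτ'j, hττ'⟩ : ∃ τ' : Fin n, τ' ∈ andPair I j₂ ∧ τ' ≠ τ := by
    rcases (mem_andPair_iff I j₂ τ).1 hτ with h | h
    · exact ⟨I.vars j₂ 3, (mem_andPair_iff I j₂ _).2 (Or.inr rfl), fun e => and_ne I hI j₂ (h.symm.trans e.symm)⟩
    · exact ⟨I.vars j₂ 2, (mem_andPair_iff I j₂ _).2 (Or.inl rfl), fun e => and_ne I hI j₂ (e.trans h)⟩
  have dj : ∀ {a b : Fin n}, a ∈ andPair I j₁ → b ∈ andPair I j₂ → a ≠ b := fun ha hb e => Finset.disjoint_left.1 hdisj ha (e ▸ hb)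
  have hστ : σ ≠ τ := dj hσ hτ
  have hστ' : σ ≠ τ' := dj hσ hτ'j
  have hσ'τ : σ' ≠ τ := dj hσ'j hτ
  have hσ'τ' : σ' ≠ τ' := dj hσ'j hτ'j
  -- adjacency in `D = {j₁, j₂}`
  have hpair : ∀ j : Fin m, ∀ {a b : Fin n}, a ∈ andPair I j → b ∈ andPair I j → a ≠ b →
      (I.vars j 2 = a ∧ I.vars j 3 = b) ∨ (I.vars j 2 = b ∧ I.vars j 3 = a) := by
    intro j a b ha hb hab
    rcases (mem_andPair_iff I j a).1 ha with h1 | h1 <;> rcases (mem_andPair_iff I j b).1 hb with h2 | h2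
    · exact absurd (h1.trans h2.symm) hab
    · exact Or.inl ⟨h1.symm, h2.symm⟩
    · exact Or.inr ⟨h2.symm, h1.symm⟩
    · exact absurd (h1.trans h2.symm) hab
  have hAdj_of : ∀ {a b : Fin n}, AndAdj I D a b → (a ∈ andPair I j₁ ∧ b ∈ andPair I j₁) ∨ (a ∈ andPair I j₂ ∧ b ∈ andPair I j₂) := by
    rintro a b ⟨j, hj, hab⟩
    rw [hD, mem_insert, mem_singleton] at hj
    rcases hj with rfl | rfl
    · left
      rcases hab with ⟨e1, e2⟩ | ⟨e1, e2⟩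
      · exact ⟨(mem_andPair_iff I _ _).2 (Or.inl e1.symm), (mem_andPair_iff I _ _).2 (Or.inr e2.symm)⟩
      · exact ⟨(mem_andPair_iff I _ _).2 (Or.inr e2.symm), (mem_andPair_iff I _ _).2 (Or.inl e1.symm)⟩
    · right
      rcases hab with ⟨e1, e2⟩ | ⟨e1, e2⟩
      · exact ⟨(mem_andPair_iff I _ _).2 (Or.inl e1.symm), (mem_andPair_iff I _ _).2 (Or.inr e2.symm)⟩
      · exact ⟨(mem_andPair_iff I _ _).2 (Or.inr e2.symm), (mem_andPair_iff I _ _).2 (Or.inl e1.symm)⟩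
  have hself : ∀ a : Fin n, ¬ AndAdj I D a a := by
    rintro a ⟨j, -, ⟨e1, e2⟩ | ⟨e1, e2⟩⟩
    · exact and_ne I hI j (e1.trans e2.symm)
    · exact and_ne I hI j (e1.trans e2.symm)
  have hcross : ∀ {a b : Fin n}, a ∈ andPair I j₁ → b ∈ andPair I j₂ → ¬ AndAdj I D a b := by
    intro a b ha hb hA
    rcases hAdj_of hA with ⟨-, hb'⟩ | ⟨ha', -⟩
    · exact Finset.disjoint_left.1 hdisj hb' hb
    · exact Finset.disjoint_left.1 hdisj ha ha'
  have hcross' : ∀ {a b : Fin n}, a ∈ andPair I j₂ → b ∈ andPair I j₁ → ¬ AndAdj I D a b := by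
    intro a b ha hb hA
    rcases hAdj_of hA with ⟨ha', -⟩ | ⟨-, hb'⟩
    · exact Finset.disjoint_left.1 hdisj ha' ha
    · exact Finset.disjoint_left.1 hdisj hb hb'
  have hj₁D : j₁ ∈ D := by rw [hD]; exact mem_insert_self _ _
  have hj₂D : j₂ ∈ D := by rw [hD]; exact mem_insert_of_mem (mem_singleton_self _)
  have hAσσ' : AndAdj I D σ σ' := ⟨j₁, hj₁D, hpair j₁ hσ hσ'j hσσ'.symm⟩
  have hAσ'σ : AndAdj I D σ' σ := ⟨j₁, hj₁D, hpair j₁ hσ'j hσ hσσ'⟩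
  have hAττ' : AndAdj I D τ τ' := ⟨j₂, hj₂D, hpair j₂ hτ hτ'j hττ'.symm⟩
  have hAτ'τ : AndAdj I D τ' τ := ⟨j₂, hj₂D, hpair j₂ hτ'j hτ hττ'⟩
  -- the Gram values on `σ', σ, τ, τ'`
  have nA : ∀ {a b : Fin n}, ¬ AndAdj I D a b → ¬ ((a = σ ∧ b = τ) ∨ (a = τ ∧ b = σ)) → P (Pi.single a 1) (Pi.single b 1) = 0 := by
    intro a b h1 h2; rw [hpol, if_neg h1, if_neg h2, add_zero]
  have yA : ∀ {a b : Fin n}, AndAdj I D a b → ¬ ((a = σ ∧ b = τ) ∨ (a = τ ∧ b = σ)) → P (Pi.single a 1) (Pi.single b 1) = 1 := by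
    intro a b h1 h2; rw [hpol, if_pos h1, if_neg h2, add_zero]
  have yG : ∀ {a b : Fin n}, ¬ AndAdj I D a b → ((a = σ ∧ b = τ) ∨ (a = τ ∧ b = σ)) → P (Pi.single a 1) (Pi.single b 1) = 1 := by
    intro a b h1 h2; rw [hpol, if_neg h1, if_pos h2, zero_add]
  have nG : ∀ {a b : Fin n}, a ≠ σ ∨ b ≠ τ → a ≠ τ ∨ b ≠ σ → ¬ ((a = σ ∧ b = τ) ∨ (a = τ ∧ b = σ)) := by
    rintro a b h1 h2 (⟨e1, e2⟩ | ⟨e1, e2⟩)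
    · rcases h1 with h | h; exacts [h e1, h e2]
    · rcases h2 with h | h; exacts [h e1, h e2]
  -- row `σ'`
  have g11 : P (Pi.single σ' 1) (Pi.single σ' 1) = 0 := nA (hself σ') (nG (Or.inl hσσ') (Or.inl hσ'τ))
  have g12 : P (Pi.single σ' 1) (Pi.single σ 1) = 1 := yA hAσ'σ (nG (Or.inl hσσ') (Or.inl hσ'τ))
  have g13 : P (Pi.single σ' 1) (Pi.single τ 1) = 0 := nA (hcross hσ'j hτ) (nG (Or.inl hσσ') (Or.inl hσ'τ))
  have g14 : P (Pi.single σ' 1) (Pi.single τ' 1) = 0 := nA (hcross hσ'j hτ'j) (nG (Or.inl hσσ') (Or.inl hσ'τ))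
  -- row `σ`
  have g21 : P (Pi.single σ 1) (Pi.single σ' 1) = 1 := yA hAσσ' (nG (Or.inr hσ'τ) (Or.inl hστ))
  have g22 : P (Pi.single σ 1) (Pi.single σ 1) = 0 := nA (hself σ) (nG (Or.inr hστ) (Or.inl hστ))
  have g23 : P (Pi.single σ 1) (Pi.single τ 1) = 1 := yG (hcross hσ hτ) (Or.inl ⟨rfl, rfl⟩)
  have g24 : P (Pi.single σ 1) (Pi.single τ' 1) = 0 := nA (hcross hσ hτ'j) (nG (Or.inr hττ') (Or.inl hστ))
  -- row `τ`
  have g31 : P (Pi.single τ 1) (Pi.single σ' 1) = 0 := nA (hcross' hτ hσ'j) (nG (Or.inl hστ.symm) (Or.inr hσσ'))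
  have g32 : P (Pi.single τ 1) (Pi.single σ 1) = 1 := yG (hcross' hτ hσ) (Or.inr ⟨rfl, rfl⟩)
  have g33 : P (Pi.single τ 1) (Pi.single τ 1) = 0 := nA (hself τ) (nG (Or.inl hστ.symm) (Or.inr hστ.symm))
  have g34 : P (Pi.single τ 1) (Pi.single τ' 1) = 1 := yA hAττ' (nG (Or.inl hστ.symm) (Or.inr hστ'.symm))
  -- row `τ'`
  have g41 : P (Pi.single τ' 1) (Pi.single σ' 1) = 0 := nA (hcross' hτ'j hσ'j) (nG (Or.inl hστ'.symm) (Or.inl hττ'))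
  have g42 : P (Pi.single τ' 1) (Pi.single σ 1) = 0 := nA (hcross' hτ'j hσ) (nG (Or.inl hστ'.symm) (Or.inl hττ'))
  have g43 : P (Pi.single τ' 1) (Pi.single τ 1) = 1 := yA hAτ'τ (nG (Or.inl hστ'.symm) (Or.inl hττ'))
  have g44 : P (Pi.single τ' 1) (Pi.single τ' 1) = 0 := nA (hself τ') (nG (Or.inl hστ'.symm) (Or.inl hττ'))
  -- the evaluation map `ψ x = (P x e_{σ'}, P x e_σ, P x e_τ, P x e_{τ'})`, onto `𝔽₂⁴`
  let f : Fin n → (Fin n → ZMod 2) →ₗ[ZMod 2] ZMod 2 := fun a => P.flip (Pi.single a 1)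
  let ψ : (Fin n → ZMod 2) →ₗ[ZMod 2] ZMod 2 × (ZMod 2 × (ZMod 2 × ZMod 2)) := (f σ').prod ((f σ).prod ((f τ).prod (f τ')))
  have hf : ∀ a x, f a x = P x (Pi.single a 1) := fun a x => rfl
  have hψ : ∀ x, ψ x = (P x (Pi.single σ' 1), (P x (Pi.single σ 1), (P x (Pi.single τ 1), P x (Pi.single τ' 1)))) := fun x => rfl
  have hsurj : Function.Surjective ψ := by
    rintro ⟨y₀, y₁, y₂, y₃⟩
    refine ⟨y₀ • (Pi.single σ 1 + Pi.single τ' 1) + y₁ • Pi.single σ' 1 + y₂ • Pi.single τ' 1 + y₃ • (Pi.single τ 1 + Pi.single σ' 1), ?_⟩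
    rw [hψ]
    simp only [map_add, map_smul, LinearMap.add_apply, LinearMap.smul_apply, smul_eq_mul,
      g11, g12, g13, g14, g21, g22, g23, g24, g31, g32, g33, g34, g41, g42, g43, g44]
    refine Prod.ext ?_ (Prod.ext ?_ (Prod.ext ?_ ?_)) <;> dsimp only <;> revert y₀ y₁ y₂ y₃ <;> decide
  have hker : rad P ≤ LinearMap.ker ψ := by
    intro x hx
    rw [LinearMap.mem_ker, hψ]
    have h0 := mem_rad.1 hx
    rw [h0, h0, h0, h0]; rfl
  have hrange : finrank (ZMod 2) (LinearMap.range ψ) = 4 := by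
    rw [LinearMap.range_eq_top.2 hsurj, finrank_top]; simp
  have hrk := LinearMap.finrank_range_add_finrank_ker ψ
  have hmono := Submodule.finrank_mono hker
  omega

end

end Summit.PneNP.PneNP.Theorems.PstarCrossUnitRank
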